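import Summits.BirchSwinnertonDyer.BirchSwinnertonDyer.Theorems.PrintCf2SplitBadTwoRestrictedSelmerControlIndex
import Literature.NumberTheory.EllipticCurves.IwasawaCoinvariantsRankProofs
import Literature.NumberTheory.EllipticCurves.GaloisActionProofs
import Literature.NumberTheory.EllipticCurves.EndomorphismEigenPrimaryTorsion
import HarnessLib

/-!
# Crux `PrintCf2.SplitBadTwoRankOneOfFacts` (stmt-BirchSwinnertonDyer-20368), road α v9.1 — the CM summand `E[𝔮^∞]`:
# the side conditions of bricks B5′–B5‴ (and of the LEAD's `RestrictedSelmerDualProofs`) DISCHARGED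

Cell `bsd-print-cf2`, width seat `bsd-line-cf2-p1-w7` g0; `--supports stmt-BirchSwinnertonDyer-20368` (helper, Theses-free).
HONEST FRAMING: nothing here closes a crux or a stub; BSD is not proved by any of this; no summit statement is proved by
this seat. No definition, no named fact, no `sorry`. For `V/K` an elliptic curve over a number field, `π ∈ End_K(V)`,
`r ∈ ℤ_p` and the discrete `Γ_K`-module `M := ↥(V.endEigenPrimaryTorsion p π r)` (p646843; road α: `V = W.baseChange K₀`, `p = 2`,
`M = W* = W[v̄^∞]`):
* `exists_pow_smul_endEigenPrimaryTorsion_eq_zero` (`htor`: `p`-primary), `isOpen_stabilizer_endEigenPrimaryTorsion` (`hstab`),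
  `continuous_smul_endEigenPrimaryTorsion` (`hcont`) — importable forms (the first two also sit in the LEAD's Cruxes skeleton v9.1);
* `finite_ker_subOne_endEigenPrimaryTorsion`, **`finite_quotient_subOne_endEigenPrimaryTorsion`** — for ANY `ℤ_p`-extension `κ`
  with topological generator `γ`: `ker` and `coker` of `γ − 1` on `M^{Gal(K̄/K_∞)}` are FINITE (Greenberg's Lemma 3.1 argument run on
  the summand: Mordell–Weil torsion + pigeonhole over `M[pⁿ] ↪ E[p^∞][pⁿ]`), discharging the hypothesis
  `Finite (M^{H_∞} ⧸ (γ − 1))` of B5′ `finite_ker_resOfLe_and_card_le` / B5‴;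
* **`control_identity_endEigenPrimaryTorsion`** — v9.1's S3c₂ `stub_restrictedEulerCharBottom_two` on the summand with NO side
  condition left: `𝔖^Γ` finite ∧ `p^n · #𝔖_Γ = u · #𝔖^Γ` ⟹ `n + v_p #𝔖_Γ + v_p #ker = v_p #𝔖_𝔮(K, M) + v_p [𝔖^Γ : res 𝔖_𝔮(K, M)]`;
  `hasCharValuationAt_control_identity_endEigenPrimaryTorsion` — the dual-datum form (v9 S3c) likewise.

presearch: not applicable (no stub, no fact filed). References: R. Greenberg, LNM 1716 (1999) §3 Lemma 3.1 [GreenbergLNM1716];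
A. Agboola, Compositio 143 (2007) §5–§6, Prop. 8.1 [Agboola2007]; K. Rubin, LNM 1716 (1999) §2 [Rubin1999]; J.-P. Serre, *Galois
Cohomology*, II §1 [SerreGaloisCohomology1997].
-/

noncomputable section

open scoped Classical

set_option linter.dupNamespace false
set_option autoImplicit false

open NumberField IsDedekindDomain Field WeierstrassCurve
open Literature.NumberTheory.EllipticCurves Literature.NumberTheory.EllipticCurves.GreenbergSelmer
open Literature.NumberTheory.EllipticCurves.Agboola2007
open Literature.NumberTheory.EllipticCurves.IwasawaAlgebra
open Literature.NumberTheory.EllipticCurves.IwasawaDual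
open Literature.NumberTheory.EllipticCurves.ResKernel
open Literature.NumberTheory.GaloisRepresentations

universe u

namespace Summit.BirchSwinnertonDyer.BirchSwinnertonDyer.Theorems.PrintCf2.RestrictedSelmerPair

section CMSummand

variable {K : Type u} [Field K] (V : WeierstrassCurve K) (p : ℕ) [Fact p.Prime] (π : V.endRing) (r : ℤ_[p])

/-- The CM summand `E[𝔮^∞] = V.endEigenPrimaryTorsion p π r` is `p`-primary (it lies in `E[p^∞]`) — hypothesis `htor` of
the LEAD's `RestrictedSelmerDualProofs` / of the bricks B5″–B5‴, importable form (the LEAD's copy lives in the Cruxes skeleton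
v9.1). [cite: Rubin1999, §2 and Prop. 5.4] -/
theorem exists_pow_smul_endEigenPrimaryTorsion_eq_zero (x : ↥(V.endEigenPrimaryTorsion p π r)) :
    ∃ k : ℕ, p ^ k • x = 0 := by
  obtain ⟨k, hk⟩ := (AddCommGroup.mem_primaryComponent).mp (x : V.geomPrimaryTorsion p).2
  refine ⟨k, Subtype.ext (Subtype.ext ?_)⟩
  have : ((p ^ k • x : ↥(V.endEigenPrimaryTorsion p π r)) : V.geomPrimaryTorsion p) =
      p ^ k • (x : V.geomPrimaryTorsion p) := AddSubmonoidClass.coe_nsmul _ _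
  rw [this, AddSubmonoidClass.coe_nsmul, ZeroMemClass.coe_zero, ZeroMemClass.coe_zero]
  exact hk

/-- Stabilisers of points of the CM summand are OPEN in `Γ_K` (they are stabilisers of geometric points,
`WeierstrassCurve.isOpen_stabilizer_point_holds`) — hypothesis `hstab`, importable form. [cite: SerreGaloisCohomology1997, II.§1] -/
theorem isOpen_stabilizer_endEigenPrimaryTorsion (x : ↥(V.endEigenPrimaryTorsion p π r)) :
    IsOpen (MulAction.stabilizer (absoluteGaloisGroup K) x : Set (absoluteGaloisGroup K)) := by
  have hx : (MulAction.stabilizer (absoluteGaloisGroup K) x : Set (absoluteGaloisGroup K)) =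
      MulAction.stabilizer (absoluteGaloisGroup K) ((x : V.geomPrimaryTorsion p) : geomPoints V) := by
    ext τ
    simp only [SetLike.mem_coe, MulAction.mem_stabilizer_iff, Subtype.ext_iff,
      WeierstrassCurve.endEigenPrimaryTorsion.coe_smul, primaryComponent.coe_smul]
  rw [hx]
  exact V.isOpen_stabilizer_point_holds _

/-- The orbit maps `σ ↦ σ • x` of the CM summand are CONTINUOUS (discrete target; restriction of the tree's
`continuous_smul_geomPrimaryTorsion` along the injection into `E[p^∞]`) — hypothesis `hcont` of brick B5′'s kernel bound.
[cite: SerreGaloisCohomology1997, II.§1] -/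
theorem continuous_smul_endEigenPrimaryTorsion (x : ↥(V.endEigenPrimaryTorsion p π r)) :
    Continuous fun σ : absoluteGaloisGroup K ↦ σ • x :=
  continuous_of_injective_comp (G := absoluteGaloisGroup K) Subtype.val_injective
    (V.continuous_smul_geomPrimaryTorsion p (x : V.geomPrimaryTorsion p))

variable [NumberField K] [V.IsElliptic] (κ : ZpExtension K p) {γ : absoluteGaloisGroup K}

/-- **The kernel of `γ − 1` on `E[𝔮^∞]^{Gal(K̄/K_∞)}` is finite** (`K` a number field, `E/K` elliptic, `κ γ = 1`): an element
of it is fixed by its open stabiliser, by `ker κ` and by `γ`, hence by all of `Γ_K` (`ZpExtension.eq_top_of_isOpen_of_kerSubgroup_le`),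
so it lies in the finite set `E[p^∞]^{Γ_K}` (`finite_fixedPoints_geomPrimaryTorsion`, Mordell–Weil torsion) — the tree's
`finite_ker_subOne` for `E[p^∞]`, run on the summand. [cite: GreenbergLNM1716, §3 Lemma 3.1 (p. 86)] -/
theorem finite_ker_subOne_endEigenPrimaryTorsion (hγ : κ.IsTopGenerator γ) :
    Finite (subOne κ.kerSubgroup ↥(V.endEigenPrimaryTorsion p π r) γ).ker := by
  have hfin := V.finite_fixedPoints_geomPrimaryTorsion p
  haveI := hfin.to_subtype
  refine Finite.of_injective (fun b ↦ (⟨(((b : FixedPoints.addSubgroup κ.kerSubgroup ↥(V.endEigenPrimaryTorsion p π r)) :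
      ↥(V.endEigenPrimaryTorsion p π r)) : V.geomPrimaryTorsion p), ?_⟩ :
      {m : V.geomPrimaryTorsion p | ∀ σ : absoluteGaloisGroup K, σ • m = m})) ?_
  · set x : ↥(V.endEigenPrimaryTorsion p π r) :=
      ((b : FixedPoints.addSubgroup κ.kerSubgroup ↥(V.endEigenPrimaryTorsion p π r)) :
        ↥(V.endEigenPrimaryTorsion p π r)) with hxdef
    have hb : γ • x - x = 0 := by
      have := (AddMonoidHom.mem_ker).mp b.2
      exact congrArg (fun z : FixedPoints.addSubgroup κ.kerSubgroup ↥(V.endEigenPrimaryTorsion p π r) ↦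
        (z : ↥(V.endEigenPrimaryTorsion p π r))) this
    have hstab := κ.eq_top_of_isOpen_of_kerSubgroup_le hγ
      (MulAction.stabilizer (absoluteGaloisGroup K) x) ?_ ?_ ?_
    · intro σ
      have hσ : σ ∈ MulAction.stabilizer (absoluteGaloisGroup K) x := by
        rw [hstab]; exact Subgroup.mem_top σ
      have hσ' : σ • x = x := hσ
      show σ • (x : V.geomPrimaryTorsion p) = (x : V.geomPrimaryTorsion p)
      rw [← WeierstrassCurve.endEigenPrimaryTorsion.coe_smul, hσ']
    · exact isOpen_stabilizer_endEigenPrimaryTorsion V p π r x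
    · intro n hn
      exact (b : FixedPoints.addSubgroup κ.kerSubgroup ↥(V.endEigenPrimaryTorsion p π r)).2 ⟨n, hn⟩
    · exact sub_eq_zero.mp hb
  · intro a b hab
    apply Subtype.ext; apply Subtype.ext; apply Subtype.ext
    exact congrArg (fun z : {m : V.geomPrimaryTorsion p | ∀ σ : absoluteGaloisGroup K, σ • m = m} ↦
      (z : V.geomPrimaryTorsion p)) hab

/-- **`B/(γ − 1)B` is finite for `B = E[𝔮^∞]^{Gal(K̄/K_∞)}`** — the side condition `Finite (M^{H_∞} ⧸ (γ − 1))` of bricks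
B5′/B5‴ DISCHARGED for the CM summand: pigeonhole (`ResKernel.finite_quotient_range_of_finite_ker`) over the finite stable pieces
`B[pⁿ] ↪ E[p^∞][pⁿ]` (`finite_torsionBy_geomPrimaryTorsion`), with `finite_ker_subOne_endEigenPrimaryTorsion`. Hence the kernel of
the bottom control map `𝔖_𝔮(K, E[𝔮^∞]) → 𝔖_𝔮(K_∞, E[𝔮^∞])` is finite (B5′ `finite_ker_resOfLe_and_card_le`, B5‴
`finite_ker_resOfLe_le_top`). [cite: GreenbergLNM1716, §3 Lemma 3.1 (p. 86)] -/
theorem finite_quotient_subOne_endEigenPrimaryTorsion (hγ : κ.IsTopGenerator γ) :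
    Finite (FixedPoints.addSubgroup κ.kerSubgroup ↥(V.endEigenPrimaryTorsion p π r) ⧸
      (subOne κ.kerSubgroup ↥(V.endEigenPrimaryTorsion p π r) γ).range) := by
  haveI := finite_ker_subOne_endEigenPrimaryTorsion V p π r κ hγ
  refine (finite_quotient_range_of_finite_ker (subOne κ.kerSubgroup ↥(V.endEigenPrimaryTorsion p π r) γ)
    (fun n ↦ AddSubgroup.torsionBy _ (p ^ n : ℕ)) (fun m n hmn ↦ ?_) (fun b ↦ ?_) (fun n ↦ ?_)
    (fun n b hb ↦ ?_)).1
  · intro b hb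
    rw [AddSubgroup.torsionBy.nsmul_iff] at hb ⊢
    obtain ⟨c, hc⟩ := Nat.pow_dvd_pow p hmn
    rw [hc, Nat.mul_comm (p ^ m) c, ← smul_smul, hb, smul_zero]
  · obtain ⟨n, hn⟩ := exists_pow_smul_endEigenPrimaryTorsion_eq_zero V p π r
      ((b : FixedPoints.addSubgroup κ.kerSubgroup ↥(V.endEigenPrimaryTorsion p π r)) :
        ↥(V.endEigenPrimaryTorsion p π r))
    refine ⟨n, ?_⟩
    rw [AddSubgroup.torsionBy.nsmul_iff]
    exact Subtype.ext hn
  · haveI := V.finite_torsionBy_geomPrimaryTorsion p n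
    refine Finite.of_injective (fun b ↦ (⟨(((b : FixedPoints.addSubgroup κ.kerSubgroup ↥(V.endEigenPrimaryTorsion p π r)) :
        ↥(V.endEigenPrimaryTorsion p π r)) : V.geomPrimaryTorsion p), ?_⟩ :
        AddSubgroup.torsionBy (V.geomPrimaryTorsion p) (p ^ n : ℕ))) ?_
    · have hb := AddSubgroup.torsionBy.nsmul_iff.mp b.2
      rw [AddSubgroup.torsionBy.nsmul_iff]
      have h1 := congrArg (fun z : FixedPoints.addSubgroup κ.kerSubgroup ↥(V.endEigenPrimaryTorsion p π r) ↦
        ((z : ↥(V.endEigenPrimaryTorsion p π r)) : V.geomPrimaryTorsion p)) hb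
      simpa only [AddSubmonoidClass.coe_nsmul, ZeroMemClass.coe_zero] using h1
    · intro a b hab
      apply Subtype.ext; apply Subtype.ext; apply Subtype.ext
      exact congrArg (fun z : AddSubgroup.torsionBy (V.geomPrimaryTorsion p) (p ^ n : ℕ) ↦ (z : V.geomPrimaryTorsion p)) hab
  · rw [AddSubgroup.torsionBy.nsmul_iff] at hb ⊢
    rw [← map_nsmul, hb, map_zero]

/-- **v9.1's S3c₂ `stub_restrictedEulerCharBottom_two`, CM summand, ALL side conditions discharged**: for `E/K` elliptic over a
number field, a `K`-rational endomorphism `π`, a `p`-adic `r`, a `ℤ_p`-extension `κ` with topological generator `γ`, a place `𝔮`,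
`M := E[𝔮^∞] = ↥(V.endEigenPrimaryTorsion p π r)`: if `𝔖_𝔮(K_∞, M)^Γ` is finite and `p^n · #𝔖_Γ = u · #𝔖^Γ` (S3c₂'s own two
clauses), then `𝔖_Γ`, `𝔖_𝔮(K, M)`, `ker = 𝔖_𝔮(K, M) ∩ ker (H¹(K, M) → H¹(K_∞, M))` are finite and
**`n + v_p #𝔖_Γ + v_p #ker = v_p #𝔖_𝔮(K, M) + v_p [𝔖^Γ : res 𝔖_𝔮(K, M)]`** (B5‴ `control_identity_of_pow_mul_natCard` with
`hcont`, `M^{H_∞}/(γ − 1)` finite supplied by this file). For road α (`V = W.baseChange K₀`, `p = 2`, `κ = κ*`, `𝔮 = v̄`) this is the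
exact reduction of S3c₂'s conclusion to the four VALUES `v₂ #𝔖_{v̄}(K₀, W*)`, `v₂ [𝔖^Γ : res]`, `v₂ #ker`, `v₂ #H¹(Γ, 𝔖)`.
[cite: Agboola2007, §5, §6, Prop. 8.1 (arXiv p0017:L17–28)] [cite: GreenbergLNM1716, §3–§4] -/
theorem control_identity_endEigenPrimaryTorsion (hγ : κ.IsTopGenerator γ) (𝔮 : HeightOneSpectrum (𝓞 K))
    [Finite (endInvariants (conjRestricted κ ↥(V.endEigenPrimaryTorsion p π r) 𝔮 γ - 1))] {n : ℕ} {u : ℤ_[p]ˣ}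
    (hu : (p : ℤ_[p]) ^ n *
        (Nat.card (EndCoinvariants (conjRestricted κ ↥(V.endEigenPrimaryTorsion p π r) 𝔮 γ - 1)) : ℤ_[p]) =
      u * Nat.card (endInvariants (conjRestricted κ ↥(V.endEigenPrimaryTorsion p π r) 𝔮 γ - 1))) :
    Finite (EndCoinvariants (conjRestricted κ ↥(V.endEigenPrimaryTorsion p π r) 𝔮 γ - 1)) ∧
    Finite (restrictedSelmerBase ↥(V.endEigenPrimaryTorsion p π r) p 𝔮) ∧
    Finite ↥(restrictedSelmerBase ↥(V.endEigenPrimaryTorsion p π r) p 𝔮 ⊓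
      (resOfLe ↥(V.endEigenPrimaryTorsion p π r) (le_top : κ.kerSubgroup ≤ ⊤)).ker) ∧
      n + padicValNat p (Nat.card (EndCoinvariants (conjRestricted κ ↥(V.endEigenPrimaryTorsion p π r) 𝔮 γ - 1))) +
          padicValNat p (Nat.card ↥(restrictedSelmerBase ↥(V.endEigenPrimaryTorsion p π r) p 𝔮 ⊓
            (resOfLe ↥(V.endEigenPrimaryTorsion p π r) (le_top : κ.kerSubgroup ≤ ⊤)).ker)) =
        padicValNat p (Nat.card (restrictedSelmerBase ↥(V.endEigenPrimaryTorsion p π r) p 𝔮)) +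
          padicValNat p ((((restrictedSelmerBase ↥(V.endEigenPrimaryTorsion p π r) p 𝔮).map
              (resOfLe ↥(V.endEigenPrimaryTorsion p π r) (le_top : κ.kerSubgroup ≤ ⊤))).addSubgroupOf
            (restrictedSelmerZp κ ↥(V.endEigenPrimaryTorsion p π r) 𝔮)).relIndex
            (endInvariants (conjRestricted κ ↥(V.endEigenPrimaryTorsion p π r) 𝔮 γ - 1))) := by
  haveI := finite_quotient_subOne_endEigenPrimaryTorsion V p π r κ hγ
  exact control_identity_of_pow_mul_natCard κ ↥(V.endEigenPrimaryTorsion p π r) 𝔮 γ hγ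
    (continuous_smul_endEigenPrimaryTorsion V p π r) hu

/-- The same for a dual datum: **v9's S3c / B5‴ `hasCharValuationAt_control_identity` on the CM summand with `htor`,
`hstab`, `hcont` and `M^{H_∞}/(γ − 1)` finite ALL DISCHARGED** — the only remaining inputs are the datum's finite generation and
`D.HasCharValuationAt n`. [cite: Agboola2007, §5, Thm. 2] [cite: GreenbergLNM1716, §4 Lemma 4.2] -/
theorem hasCharValuationAt_control_identity_endEigenPrimaryTorsion (hγ : κ.IsTopGenerator γ)
    (𝔮 : HeightOneSpectrum (𝓞 K)) (D : RestrictedDualData κ ↥(V.endEigenPrimaryTorsion p π r) 𝔮 γ)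
    [Module.Finite (IwasawaAlgebra p) D.X] {n : ℕ} (h : D.HasCharValuationAt n) :
    Finite (endInvariants (conjRestricted κ ↥(V.endEigenPrimaryTorsion p π r) 𝔮 γ - 1)) ∧
    Finite (EndCoinvariants (conjRestricted κ ↥(V.endEigenPrimaryTorsion p π r) 𝔮 γ - 1)) ∧
    Finite (restrictedSelmerBase ↥(V.endEigenPrimaryTorsion p π r) p 𝔮) ∧
    Finite ↥(restrictedSelmerBase ↥(V.endEigenPrimaryTorsion p π r) p 𝔮 ⊓
      (resOfLe ↥(V.endEigenPrimaryTorsion p π r) (le_top : κ.kerSubgroup ≤ ⊤)).ker) ∧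
      n + padicValNat p (Nat.card (EndCoinvariants (conjRestricted κ ↥(V.endEigenPrimaryTorsion p π r) 𝔮 γ - 1))) +
          padicValNat p (Nat.card ↥(restrictedSelmerBase ↥(V.endEigenPrimaryTorsion p π r) p 𝔮 ⊓
            (resOfLe ↥(V.endEigenPrimaryTorsion p π r) (le_top : κ.kerSubgroup ≤ ⊤)).ker)) =
        padicValNat p (Nat.card (restrictedSelmerBase ↥(V.endEigenPrimaryTorsion p π r) p 𝔮)) +
          padicValNat p ((((restrictedSelmerBase ↥(V.endEigenPrimaryTorsion p π r) p 𝔮).map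
              (resOfLe ↥(V.endEigenPrimaryTorsion p π r) (le_top : κ.kerSubgroup ≤ ⊤))).addSubgroupOf
            (restrictedSelmerZp κ ↥(V.endEigenPrimaryTorsion p π r) 𝔮)).relIndex
            (endInvariants (conjRestricted κ ↥(V.endEigenPrimaryTorsion p π r) 𝔮 γ - 1))) := by
  haveI := finite_quotient_subOne_endEigenPrimaryTorsion V p π r κ hγ
  exact hasCharValuationAt_control_identity κ ↥(V.endEigenPrimaryTorsion p π r) 𝔮 γ D
    (exists_pow_smul_endEigenPrimaryTorsion_eq_zero V p π r) (isOpen_stabilizer_endEigenPrimaryTorsion V p π r) hγ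
    (continuous_smul_endEigenPrimaryTorsion V p π r) h

end CMSummand

end Summit.BirchSwinnertonDyer.BirchSwinnertonDyer.Theorems.PrintCf2.RestrictedSelmerPair

end
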